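import Mathlib
import HarnessLib
import Summits.HubbardSuperconductivity.HubbardSuperconductivity.Theorems.KLProgrammeKLRegimeEnginePairTransferMemberDefectDiffRows

/-!
# Route `KLProgramme` — ENGINE child gen 8 (stmt-HubbardSuperconductivity-20437 `KLRegimeEngineV17F2`), skeleton v2 class #5 rev 3: the ξᵢ / ξΔ doors KEYED ON THE
# CUTOFF-BUILT FAMILY (row 29's binder conventions) — `klmd_softSymbolCompl_even`, **`klmd_defect_le_rows_family`**, **`klmd_defectDiff_le_rows_family`**
# (cell gate-hubbard-kl, seat hubbard-kl-k3c1-p1 g13, technique «composed-map remainder propagation»; zero-friction form of `…MemberDefectDiffRows` for rows 24/29/30)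

WHY.  Rows 24/29/30 of KLTC-INDEX (`pairTransferRelResIdx_family_succ_of_analytic(_split)`, `…Step7AnalyticModel`) quantify their curves as FAMILIES
`A A′ : ℕ → TorusSite → ℝ → Matrix`, `b′ : ℕ → TorusSite → ℝ → TorusSite → ℂ` pinned by ONE equation each over `(j, Qm, t)` with the member symbol
`s_{n+1,j} = softSymbolCompl K (n+1) j`, and ask per pair `(j, j′)` and class `Qm` for `hS₁ hS₂ : ‖(Ȧ_j + A_j·diag ḃ_j·A_j)(t)(x,y)‖ ≤ ξᵢ` and
`hΔ : ‖((Ȧ_j + …) − (Ȧ_{j′} + …))(t)(x,y)‖ ≤ ξΔ`.  This file re-keys the doors of `…MemberDefectDiffRows` to exactly that shape (any frame `K`; the consumer takes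
`K := K_{n+1}`): arrays `A j Qm`, kernel pins indexed by `j` (`V V6 Sg Hd Φ`) / by `(j, Qm)` (`Br`), evenness of the family symbols discharged
(`klmd_softSymbolCompl_even`).  The rows are the five classes (ξᵢ) / nine `D`-carrying sums (ξΔ, `D = s_{n+1,j} − s_{n+1,j′} = s_{j′,j}`) at `(t,x,y)`.
Plumbing only; the SIZE of every row stays the analytic lanes'; nothing asserts (X).3, (c), K3 or superconductivity.  0 kit · 0 lit.
-/

noncomputable section

namespace Summit.HubbardSuperconductivity.HubbardSuperconductivity.Theorems.KLRegimeSplit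

set_option linter.dupNamespace false -- summit = problem name (single-conjunct summit), D-0017

open Finset Matrix Set Literature.MathematicalPhysics.QuantumLattice Literature.Probability.LatticeModels GrassmannAlgebra
open Summit.HubbardSuperconductivity.HubbardSuperconductivity.Theorems.KLProgrammeLegKernels
open Summit.HubbardSuperconductivity.HubbardSuperconductivity.Theorems.TwoPointAssembly
open Summit.HubbardSuperconductivity.HubbardSuperconductivity.Theorems.DispersionFlow
open Summit.HubbardSuperconductivity.HubbardSuperconductivity.Theorems.KLRegimeWick

variable (L M : ℕ) [NeZero L] [NeZero M] (β U μ : ℝ) (K : TrigPolyC4v)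

/-! ## §1 Evenness of the family symbols -/

omit [NeZero L] [NeZero M] in
/-- Every complementary symbol `s^K_{n,m}` is even in the frequency (any `n m`). -/
theorem klmd_softSymbolCompl_even (n m : ℕ) (k : FreqMomentum L M) :
    softSymbolCompl L M β μ K n m (k.1.rev, k.2) = softSymbolCompl L M β μ K n m k := by
  unfold softSymbolCompl
  rw [hubbardCutoffWeightCT_revFreq, hubbardCutoffWeightCT_revFreq]

/-! ## §2 The ξᵢ door on the family -/

set_option maxHeartbeats 1600000 in -- instantiation of `klmd_defect_le_rows`; plumbing only
/-- **`klmd_defect_le_rows_family`** — `klmd_defect_le_rows` for the member `j` of the cutoff-built family at frame `K` (arrays and kernel pins indexed by `j`/`(j,Qm)` as in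
row 29; pass `rfl` for every pin): five class rows at `(t,x,y)` ⟹ `‖(Ȧ_j + A_j·diag ḃ_j·A_j)(t)(x,y)‖ ≤ (Λₙ − Λ_{n+1})(½RH + (βL²)⁻³(RP + RQ + 2RS)) + RL`. -/
theorem klmd_defect_le_rows_family (hβ : 0 < β) (n : ℕ)
    (A A' : ℕ → TorusSite 2 L → ℝ → Matrix (TorusSite 2 L) (TorusSite 2 L) ℂ) (b' : ℕ → TorusSite 2 L → ℝ → TorusSite 2 L → ℂ)
    (hAdef : A = fun j Qm t => Matrix.of fun k k' : TorusSite 2 L => if k ∈ klBall L μ 0 ∧ k' ∈ klBall L μ 0 then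
      vertexFn L M β (gaussConv ℂ (softCovOf L M β μ K (softSymbolCompl L M β μ K (n + 1) j) + hubbardCovAboveCT L M β μ 0 K (klScale klE0 (n + 1)) - hubbardCovAboveCT L M β μ 0 K
              (klScale klE0 n + t * (klScale klE0 (n + 1) - klScale klE0 n))) (hubbardEffectiveActionCT L M β U μ 0 K (klScale klE0 n + t * (klScale klE0 (n + 1) - klScale klE0 n)))) 4
              ![(((omega0 M, k'), 0), 0), ((((omega0 M).rev, Qm - k'), 1), 0), ((((omega0 M).rev, Qm - k), 1), 1), (((omega0 M, k), 0), 1)]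
      else 0)
    (hA'def : A' = fun j Qm t => Matrix.of fun k k' : TorusSite 2 L => if k ∈ klBall L μ 0 ∧ k' ∈ klBall L μ 0 then
      (klScale klE0 (n + 1) - klScale klE0 n) • -((2 : ℂ)⁻¹ * vertexFn L M β (gaussConv ℂ (softCovOf L M β μ K (softSymbolCompl L M β μ K (n + 1) j) + hubbardCovAboveCT L M β μ 0 K
              (klScale klE0 (n + 1)) - hubbardCovAboveCT L M β μ 0 K (klScale klE0 n + t * (klScale klE0 (n + 1) - klScale klE0 n))) (grassmannDerivPairing ℂ (Matrix.of fun X Y :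
              HubbardFieldIdx L M => deriv (fun Λ'' : ℝ => hubbardCovAboveCT L M β μ 0 K Λ'' X Y) (klScale klE0 n + t * (klScale klE0 (n + 1) - klScale klE0 n)))
              (hubbardEffectiveActionCT L M β U μ 0 K (klScale klE0 n + t * (klScale klE0 (n + 1) - klScale klE0 n))) (hubbardEffectiveActionCT L M β U μ 0 K (klScale klE0 n + t *
              (klScale klE0 (n + 1) - klScale klE0 n))))) 4 ![(((omega0 M, k'), 0), 0), ((((omega0 M).rev, Qm - k'), 1), 0), ((((omega0 M).rev, Qm - k), 1), 1), (((omega0 M, k), 0),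
              1)])
      else 0)
    (hb'def : b' = fun (j : ℕ) (Qm : TorusSite 2 L) (t : ℝ) (p : TorusSite 2 L) => (((klScale klE0 (n + 1) - klScale klE0 n) *
        (klBubbleMass L M β μ K (fun k => deriv (fun Λ' => hubbardCutoffWeightCT L M β μ K Λ' k) (klScale klE0 n + t * (klScale klE0 (n + 1) - klScale klE0 n))) (fun k =>
                (softSymbolCompl L M β μ K (n + 1) j) k + (hubbardCutoffWeightCT L M β μ K (klScale klE0 (n + 1)) k - hubbardCutoffWeightCT L M β μ K (klScale klE0 n + t * (klScale
                klE0 (n + 1) - klScale klE0 n)) k)) Qm p +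
          klBubbleMass L M β μ K (fun k => (softSymbolCompl L M β μ K (n + 1) j) k + (hubbardCutoffWeightCT L M β μ K (klScale klE0 (n + 1)) k - hubbardCutoffWeightCT L M β μ K
                  (klScale klE0 n + t * (klScale klE0 (n + 1) - klScale klE0 n)) k)) (fun k => deriv (fun Λ' => hubbardCutoffWeightCT L M β μ K Λ' k) (klScale klE0 n + t * (klScale
                  klE0 (n + 1) - klScale klE0 n))) Qm p) : ℝ) : ℂ))
    (V : ℕ → ℝ → (Fin 4 → HubbardFieldIdx L M) → ℂ) (hV : V = fun j t X => vertexFn L M β (gaussConv ℂ (softCovOf L M β μ K (softSymbolCompl L M β μ K (n + 1) j) + hubbardCovAboveCT L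
            M β μ 0 K (klScale klE0 (n + 1)) - hubbardCovAboveCT L M β μ 0 K (klScale klE0 n + t * (klScale klE0 (n + 1) - klScale klE0 n))) (hubbardEffectiveActionCT L M β U μ 0 K
            (klScale klE0 n + t * (klScale klE0 (n + 1) - klScale klE0 n)))) 4 X)
    (V6 : ℕ → ℝ → (Fin 6 → HubbardFieldIdx L M) → ℂ) (hV6 : V6 = fun j t X => vertexFn L M β (gaussConv ℂ (softCovOf L M β μ K (softSymbolCompl L M β μ K (n + 1) j) + hubbardCovAboveCT
            L M β μ 0 K (klScale klE0 (n + 1)) - hubbardCovAboveCT L M β μ 0 K (klScale klE0 n + t * (klScale klE0 (n + 1) - klScale klE0 n))) (hubbardEffectiveActionCT L M β U μ 0 K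
            (klScale klE0 n + t * (klScale klE0 (n + 1) - klScale klE0 n)))) 6 X)
    (Sg : ℕ → ℝ → FreqMomentum L M → Fin 2 → ℂ) (hSg : Sg = fun j t p σ => selfEnergy L M β (gaussConv ℂ (softCovOf L M β μ K (softSymbolCompl L M β μ K (n + 1) j) + hubbardCovAboveCT
            L M β μ 0 K (klScale klE0 (n + 1)) - hubbardCovAboveCT L M β μ 0 K (klScale klE0 n + t * (klScale klE0 (n + 1) - klScale klE0 n))) (hubbardEffectiveActionCT L M β U μ 0 K
            (klScale klE0 n + t * (klScale klE0 (n + 1) - klScale klE0 n)))) p σ)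
    (Hd : ℕ → ℝ → (Fin 4 → HubbardFieldIdx L M) → ℂ) (hHd : Hd = fun j t X => vertexFn L M β (dblFold ℂ (grassmannLaplacian ℂ (crossCov ℂ (Matrix.of fun X Y : HubbardFieldIdx L M =>
            deriv (fun Λ' : ℝ => hubbardCovAboveCT L M β μ 0 K Λ' X Y) (klScale klE0 n + t * (klScale klE0 (n + 1) - klScale klE0 n)))) ((gaussConv ℂ (crossCov ℂ (softCovOf L M β μ K
            (softSymbolCompl L M β μ K (n + 1) j) + hubbardCovAboveCT L M β μ 0 K (klScale klE0 (n + 1)) - hubbardCovAboveCT L M β μ 0 K (klScale klE0 n + t * (klScale klE0 (n + 1) -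
            klScale klE0 n)))) - grassmannLaplacian ℂ (crossCov ℂ (softCovOf L M β μ K (softSymbolCompl L M β μ K (n + 1) j) + hubbardCovAboveCT L M β μ 0 K (klScale klE0 (n + 1)) -
            hubbardCovAboveCT L M β μ 0 K (klScale klE0 n + t * (klScale klE0 (n + 1) - klScale klE0 n))))) (dblCopy ℂ 0 (gaussConv ℂ (softCovOf L M β μ K (softSymbolCompl L M β μ K (n
            + 1) j) + hubbardCovAboveCT L M β μ 0 K (klScale klE0 (n + 1)) - hubbardCovAboveCT L M β μ 0 K (klScale klE0 n + t * (klScale klE0 (n + 1) - klScale klE0 n)))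
            (hubbardEffectiveActionCT L M β U μ 0 K (klScale klE0 n + t * (klScale klE0 (n + 1) - klScale klE0 n)))) * dblCopy ℂ 1 (gaussConv ℂ (softCovOf L M β μ K (softSymbolCompl L
            M β μ K (n + 1) j) + hubbardCovAboveCT L M β μ 0 K (klScale klE0 (n + 1)) - hubbardCovAboveCT L M β μ 0 K (klScale klE0 n + t * (klScale klE0 (n + 1) - klScale klE0 n)))
            (hubbardEffectiveActionCT L M β U μ 0 K (klScale klE0 n + t * (klScale klE0 (n + 1) - klScale klE0 n)))))))) 4 X)
    (Φ : ℕ → ℝ → FreqMomentum L M → ℝ) (hΦ : Φ = fun j t k => (softSymbolCompl L M β μ K (n + 1) j) k + (hubbardCutoffWeightCT L M β μ K (klScale klE0 (n + 1)) k -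
            hubbardCutoffWeightCT L M β μ K (klScale klE0 n + t * (klScale klE0 (n + 1) - klScale klE0 n)) k))
    (Wd : ℝ → FreqMomentum L M → ℝ) (hWd : Wd = fun t k => deriv (fun Λ' : ℝ => hubbardCutoffWeightCT L M β μ K Λ' k) (klScale klE0 n + t * (klScale klE0 (n + 1) - klScale klE0 n)))
    (Br : ℕ → TorusSite 2 L → ℝ → TorusSite 2 L × MatsubaraIdx M → ℂ) (hBr : Br = fun j Qm t z => -(((((β * (L : ℝ) ^ 2 : ℝ) : ℂ)))⁻¹ * propCT L M β μ K (z.2, z.1) * propCT L M β μ K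
            (z.2.rev, Qm - z.1)) *
      ((((klScale klE0 (n + 1) - klScale klE0 n) * (-Wd t (z.2, z.1) * Φ j t (z.2.rev, Qm - z.1) - Φ j t (z.2, z.1) * Wd t (z.2.rev, Qm - z.1))) : ℝ) : ℂ))
    (j : ℕ) (Qm : TorusSite 2 L) {t : ℝ} (ht : t ∈ Icc (0 : ℝ) 1) (x y : TorusSite 2 L) {RH RP RQ RS RL : ℝ}
    (hH : ‖Hd j t ![(((omega0 M, y), 0), 0), ((((omega0 M).rev, Qm - y), 1), 0), ((((omega0 M).rev, Qm - x), 1), 1), (((omega0 M, x), 0), 1)]‖ ≤ RH)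
    (hP : ‖(∑ p : FreqMomentum L M, ∑ σ : Fin 2, ∑ p' : FreqMomentum L M,
            if matsubaraInt M p'.1 + matsubaraInt M (omega0 M) = matsubaraInt M p.1 + matsubaraInt M (omega0 M) ∧ p'.2 = p.2 + x - y then
              ((((((Φ j t p) : ℝ) : ℂ) * (((β * (L : ℝ) ^ 2 : ℝ) : ℂ) * propCT L M β μ K p)) * ((((Wd t p') : ℝ) : ℂ) * (((β * (L : ℝ) ^ 2 : ℝ) : ℂ) * propCT L M β μ K p'))) + (((((Wd
                      t p) : ℝ) : ℂ) * (((β * (L : ℝ) ^ 2 : ℝ) : ℂ) * propCT L M β μ K p)) * ((((Φ j t p') : ℝ) : ℂ) * (((β * (L : ℝ) ^ 2 : ℝ) : ℂ) * propCT L M β μ K p')))) *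
                (V j t ![((p, σ), 1), ((p', σ), 0), (((omega0 M, y), 0), 0), (((omega0 M, x), 0), 1)] *
                  V j t ![((p, σ), 0), ((p', σ), 1), ((((omega0 M).rev, Qm - y), 1), 0), ((((omega0 M).rev, Qm - x), 1), 1)])
            else 0)‖ ≤ RP)
    (hQ : ‖(∑ p : FreqMomentum L M, ∑ p' : FreqMomentum L M,
            if matsubaraInt M p'.1 + matsubaraInt M (omega0 M) + matsubaraInt M (omega0 M) + 1 = matsubaraInt M p.1 ∧ p'.2 = p.2 + Qm - x - y then
              ((((((Φ j t p) : ℝ) : ℂ) * (((β * (L : ℝ) ^ 2 : ℝ) : ℂ) * propCT L M β μ K p)) * ((((Wd t p') : ℝ) : ℂ) * (((β * (L : ℝ) ^ 2 : ℝ) : ℂ) * propCT L M β μ K p'))) + (((((Wd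
                      t p) : ℝ) : ℂ) * (((β * (L : ℝ) ^ 2 : ℝ) : ℂ) * propCT L M β μ K p)) * ((((Φ j t p') : ℝ) : ℂ) * (((β * (L : ℝ) ^ 2 : ℝ) : ℂ) * propCT L M β μ K p')))) *
                (V j t ![((p, 0), 1), ((p', 1), 0), (((omega0 M, y), 0), 0), ((((omega0 M).rev, Qm - x), 1), 1)] *
                  V j t ![((p, 0), 0), ((p', 1), 1), ((((omega0 M).rev, Qm - y), 1), 0), (((omega0 M, x), 0), 1)])
            else 0)‖ ≤ RQ)
    (hS : ‖(∑ p : FreqMomentum L M, ∑ σ : Fin 2,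
            (((((Wd t p) : ℝ) : ℂ) * (((β * (L : ℝ) ^ 2 : ℝ) : ℂ) * propCT L M β μ K p)) * ((((Φ j t p) : ℝ) : ℂ) * (((β * (L : ℝ) ^ 2 : ℝ) : ℂ) * propCT L M β μ K p))) *
              (V6 j t ![((p, σ), 0), ((p, σ), 1), (((omega0 M, y), 0), 0), ((((omega0 M).rev, Qm - y), 1), 0), ((((omega0 M).rev, Qm - x), 1), 1),
                (((omega0 M, x), 0), 1)] *
                Sg j t p σ))‖ ≤ RS)
    (hL : ‖∑ z : TorusSite 2 L × MatsubaraIdx M, Br j Qm t z *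
          ((if z.1 ∈ klBall L μ 0 then
              V j t ![(((omega0 M, z.1), 0), 0), ((((omega0 M).rev, Qm - z.1), 1), 0), ((((omega0 M).rev, Qm - x), 1), 1), (((omega0 M, x), 0), 1)] *
                V j t ![(((omega0 M, y), 0), 0), ((((omega0 M).rev, Qm - y), 1), 0), ((((omega0 M).rev, Qm - z.1), 1), 1), (((omega0 M, z.1), 0), 1)]
            else 0) -
            V j t ![(((z.2, z.1), 0), 0), (((z.2.rev, Qm - z.1), 1), 0), ((((omega0 M).rev, Qm - x), 1), 1), (((omega0 M, x), 0), 1)] *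
              V j t ![(((omega0 M, y), 0), 0), ((((omega0 M).rev, Qm - y), 1), 0), (((z.2.rev, Qm - z.1), 1), 1), (((z.2, z.1), 0), 1)])‖ ≤ RL) :
    ‖(A' j Qm t + A j Qm t * diagonal (b' j Qm t) * A j Qm t) x y‖ ≤
      (klScale klE0 n - klScale klE0 (n + 1)) * (2⁻¹ * RH + ((β * (L : ℝ) ^ 2) ^ 3)⁻¹ * (RP + RQ + 2 * RS)) + RL := by
  exact klmd_defect_le_rows L M β U μ K hβ n (klmd_softSymbolCompl_even L M β μ K (n + 1) j) Qm (A j Qm) (A' j Qm) (b' j Qm)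
    (by rw [hAdef]) (by rw [hA'def]) (by rw [hb'def]) (V j) (by rw [hV]) (V6 j) (by rw [hV6]) (Sg j) (by rw [hSg]) (Hd j) (by rw [hHd]) (Φ j) (by rw [hΦ])
    Wd hWd (Br j Qm) (by rw [hBr]) ht x y hH hP hQ hS hL

/-! ## §3 The ξΔ door on the family -/

set_option maxHeartbeats 1600000 in -- instantiation of `klmd_defectDiff_le_rows`; plumbing only
/-- **`klmd_defectDiff_le_rows_family`** — `klmd_defectDiff_le_rows` for the pair `(j, j′)` of the cutoff-built family at frame `K` (same binders as
`klmd_defect_le_rows_family`): nine `D`-carrying rows at `(t,x,y)` with `D = s_{n+1,j} − s_{n+1,j′}` LITERAL ⟹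
`‖((Ȧ_j + A_j·diag ḃ_j·A_j) − (Ȧ_{j′} + A_{j′}·diag ḃ_{j′}·A_{j′}))(t)(x,y)‖ ≤ (Λₙ − Λ_{n+1})(½Rhd + (βL²)⁻³(Rd₁ + Rd₂ + Rx₁ + Rx₂ + 2(R6₁ + R6₂))) + Rl₁ + Rl₂` — row 29's `hΔ`. -/
theorem klmd_defectDiff_le_rows_family (hβ : 0 < β) (n : ℕ)
    (A A' : ℕ → TorusSite 2 L → ℝ → Matrix (TorusSite 2 L) (TorusSite 2 L) ℂ) (b' : ℕ → TorusSite 2 L → ℝ → TorusSite 2 L → ℂ)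
    (hAdef : A = fun j Qm t => Matrix.of fun k k' : TorusSite 2 L => if k ∈ klBall L μ 0 ∧ k' ∈ klBall L μ 0 then
      vertexFn L M β (gaussConv ℂ (softCovOf L M β μ K (softSymbolCompl L M β μ K (n + 1) j) + hubbardCovAboveCT L M β μ 0 K (klScale klE0 (n + 1)) - hubbardCovAboveCT L M β μ 0 K
              (klScale klE0 n + t * (klScale klE0 (n + 1) - klScale klE0 n))) (hubbardEffectiveActionCT L M β U μ 0 K (klScale klE0 n + t * (klScale klE0 (n + 1) - klScale klE0 n)))) 4
              ![(((omega0 M, k'), 0), 0), ((((omega0 M).rev, Qm - k'), 1), 0), ((((omega0 M).rev, Qm - k), 1), 1), (((omega0 M, k), 0), 1)]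
      else 0)
    (hA'def : A' = fun j Qm t => Matrix.of fun k k' : TorusSite 2 L => if k ∈ klBall L μ 0 ∧ k' ∈ klBall L μ 0 then
      (klScale klE0 (n + 1) - klScale klE0 n) • -((2 : ℂ)⁻¹ * vertexFn L M β (gaussConv ℂ (softCovOf L M β μ K (softSymbolCompl L M β μ K (n + 1) j) + hubbardCovAboveCT L M β μ 0 K
              (klScale klE0 (n + 1)) - hubbardCovAboveCT L M β μ 0 K (klScale klE0 n + t * (klScale klE0 (n + 1) - klScale klE0 n))) (grassmannDerivPairing ℂ (Matrix.of fun X Y :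
              HubbardFieldIdx L M => deriv (fun Λ'' : ℝ => hubbardCovAboveCT L M β μ 0 K Λ'' X Y) (klScale klE0 n + t * (klScale klE0 (n + 1) - klScale klE0 n)))
              (hubbardEffectiveActionCT L M β U μ 0 K (klScale klE0 n + t * (klScale klE0 (n + 1) - klScale klE0 n))) (hubbardEffectiveActionCT L M β U μ 0 K (klScale klE0 n + t *
              (klScale klE0 (n + 1) - klScale klE0 n))))) 4 ![(((omega0 M, k'), 0), 0), ((((omega0 M).rev, Qm - k'), 1), 0), ((((omega0 M).rev, Qm - k), 1), 1), (((omega0 M, k), 0),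
              1)])
      else 0)
    (hb'def : b' = fun (j : ℕ) (Qm : TorusSite 2 L) (t : ℝ) (p : TorusSite 2 L) => (((klScale klE0 (n + 1) - klScale klE0 n) *
        (klBubbleMass L M β μ K (fun k => deriv (fun Λ' => hubbardCutoffWeightCT L M β μ K Λ' k) (klScale klE0 n + t * (klScale klE0 (n + 1) - klScale klE0 n))) (fun k =>
                (softSymbolCompl L M β μ K (n + 1) j) k + (hubbardCutoffWeightCT L M β μ K (klScale klE0 (n + 1)) k - hubbardCutoffWeightCT L M β μ K (klScale klE0 n + t * (klScale
                klE0 (n + 1) - klScale klE0 n)) k)) Qm p +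
          klBubbleMass L M β μ K (fun k => (softSymbolCompl L M β μ K (n + 1) j) k + (hubbardCutoffWeightCT L M β μ K (klScale klE0 (n + 1)) k - hubbardCutoffWeightCT L M β μ K
                  (klScale klE0 n + t * (klScale klE0 (n + 1) - klScale klE0 n)) k)) (fun k => deriv (fun Λ' => hubbardCutoffWeightCT L M β μ K Λ' k) (klScale klE0 n + t * (klScale
                  klE0 (n + 1) - klScale klE0 n))) Qm p) : ℝ) : ℂ))
    (V : ℕ → ℝ → (Fin 4 → HubbardFieldIdx L M) → ℂ) (hV : V = fun j t X => vertexFn L M β (gaussConv ℂ (softCovOf L M β μ K (softSymbolCompl L M β μ K (n + 1) j) + hubbardCovAboveCT L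
            M β μ 0 K (klScale klE0 (n + 1)) - hubbardCovAboveCT L M β μ 0 K (klScale klE0 n + t * (klScale klE0 (n + 1) - klScale klE0 n))) (hubbardEffectiveActionCT L M β U μ 0 K
            (klScale klE0 n + t * (klScale klE0 (n + 1) - klScale klE0 n)))) 4 X)
    (V6 : ℕ → ℝ → (Fin 6 → HubbardFieldIdx L M) → ℂ) (hV6 : V6 = fun j t X => vertexFn L M β (gaussConv ℂ (softCovOf L M β μ K (softSymbolCompl L M β μ K (n + 1) j) + hubbardCovAboveCT
            L M β μ 0 K (klScale klE0 (n + 1)) - hubbardCovAboveCT L M β μ 0 K (klScale klE0 n + t * (klScale klE0 (n + 1) - klScale klE0 n))) (hubbardEffectiveActionCT L M β U μ 0 K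
            (klScale klE0 n + t * (klScale klE0 (n + 1) - klScale klE0 n)))) 6 X)
    (Sg : ℕ → ℝ → FreqMomentum L M → Fin 2 → ℂ) (hSg : Sg = fun j t p σ => selfEnergy L M β (gaussConv ℂ (softCovOf L M β μ K (softSymbolCompl L M β μ K (n + 1) j) + hubbardCovAboveCT
            L M β μ 0 K (klScale klE0 (n + 1)) - hubbardCovAboveCT L M β μ 0 K (klScale klE0 n + t * (klScale klE0 (n + 1) - klScale klE0 n))) (hubbardEffectiveActionCT L M β U μ 0 K
            (klScale klE0 n + t * (klScale klE0 (n + 1) - klScale klE0 n)))) p σ)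
    (Hd : ℕ → ℝ → (Fin 4 → HubbardFieldIdx L M) → ℂ) (hHd : Hd = fun j t X => vertexFn L M β (dblFold ℂ (grassmannLaplacian ℂ (crossCov ℂ (Matrix.of fun X Y : HubbardFieldIdx L M =>
            deriv (fun Λ' : ℝ => hubbardCovAboveCT L M β μ 0 K Λ' X Y) (klScale klE0 n + t * (klScale klE0 (n + 1) - klScale klE0 n)))) ((gaussConv ℂ (crossCov ℂ (softCovOf L M β μ K
            (softSymbolCompl L M β μ K (n + 1) j) + hubbardCovAboveCT L M β μ 0 K (klScale klE0 (n + 1)) - hubbardCovAboveCT L M β μ 0 K (klScale klE0 n + t * (klScale klE0 (n + 1) -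
            klScale klE0 n)))) - grassmannLaplacian ℂ (crossCov ℂ (softCovOf L M β μ K (softSymbolCompl L M β μ K (n + 1) j) + hubbardCovAboveCT L M β μ 0 K (klScale klE0 (n + 1)) -
            hubbardCovAboveCT L M β μ 0 K (klScale klE0 n + t * (klScale klE0 (n + 1) - klScale klE0 n))))) (dblCopy ℂ 0 (gaussConv ℂ (softCovOf L M β μ K (softSymbolCompl L M β μ K (n
            + 1) j) + hubbardCovAboveCT L M β μ 0 K (klScale klE0 (n + 1)) - hubbardCovAboveCT L M β μ 0 K (klScale klE0 n + t * (klScale klE0 (n + 1) - klScale klE0 n)))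
            (hubbardEffectiveActionCT L M β U μ 0 K (klScale klE0 n + t * (klScale klE0 (n + 1) - klScale klE0 n)))) * dblCopy ℂ 1 (gaussConv ℂ (softCovOf L M β μ K (softSymbolCompl L
            M β μ K (n + 1) j) + hubbardCovAboveCT L M β μ 0 K (klScale klE0 (n + 1)) - hubbardCovAboveCT L M β μ 0 K (klScale klE0 n + t * (klScale klE0 (n + 1) - klScale klE0 n)))
            (hubbardEffectiveActionCT L M β U μ 0 K (klScale klE0 n + t * (klScale klE0 (n + 1) - klScale klE0 n)))))))) 4 X)
    (Φ : ℕ → ℝ → FreqMomentum L M → ℝ) (hΦ : Φ = fun j t k => (softSymbolCompl L M β μ K (n + 1) j) k + (hubbardCutoffWeightCT L M β μ K (klScale klE0 (n + 1)) k -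
            hubbardCutoffWeightCT L M β μ K (klScale klE0 n + t * (klScale klE0 (n + 1) - klScale klE0 n)) k))
    (Wd : ℝ → FreqMomentum L M → ℝ) (hWd : Wd = fun t k => deriv (fun Λ' : ℝ => hubbardCutoffWeightCT L M β μ K Λ' k) (klScale klE0 n + t * (klScale klE0 (n + 1) - klScale klE0 n)))
    (Br : ℕ → TorusSite 2 L → ℝ → TorusSite 2 L × MatsubaraIdx M → ℂ) (hBr : Br = fun j Qm t z => -(((((β * (L : ℝ) ^ 2 : ℝ) : ℂ)))⁻¹ * propCT L M β μ K (z.2, z.1) * propCT L M β μ K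
            (z.2.rev, Qm - z.1)) *
      ((((klScale klE0 (n + 1) - klScale klE0 n) * (-Wd t (z.2, z.1) * Φ j t (z.2.rev, Qm - z.1) - Φ j t (z.2, z.1) * Wd t (z.2.rev, Qm - z.1))) : ℝ) : ℂ))
    (j j' : ℕ) (Qm : TorusSite 2 L) {t : ℝ} (ht : t ∈ Icc (0 : ℝ) 1) (x y : TorusSite 2 L) {Rhd Rd₁ Rd₂ Rx₁ Rx₂ R6₁ R6₂ Rl₁ Rl₂ : ℝ}
    (hRhd : ‖Hd j t ![(((omega0 M, y), 0), 0), ((((omega0 M).rev, Qm - y), 1), 0), ((((omega0 M).rev, Qm - x), 1), 1), (((omega0 M, x), 0), 1)] - Hd j' t ![(((omega0 M, y), 0), 0),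
            ((((omega0 M).rev, Qm - y), 1), 0), ((((omega0 M).rev, Qm - x), 1), 1), (((omega0 M, x), 0), 1)]‖ ≤ Rhd)
    (hd₁ : ‖(∑ p : FreqMomentum L M, ∑ σ : Fin 2, ∑ p' : FreqMomentum L M,
            if matsubaraInt M p'.1 + matsubaraInt M (omega0 M) = matsubaraInt M p.1 + matsubaraInt M (omega0 M) ∧ p'.2 = p.2 + x - y then
              ((((((((softSymbolCompl L M β μ K (n + 1) j) p - (softSymbolCompl L M β μ K (n + 1) j') p)) : ℝ) : ℂ) * (((β * (L : ℝ) ^ 2 : ℝ) : ℂ) * propCT L M β μ K p)) * ((((Wd t p')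
                      : ℝ) : ℂ) * (((β * (L : ℝ) ^ 2 : ℝ) : ℂ) * propCT L M β μ K p'))) + (((((Wd t p) : ℝ) : ℂ) * (((β * (L : ℝ) ^ 2 : ℝ) : ℂ) * propCT L M β μ K p)) *
                      ((((((softSymbolCompl L M β μ K (n + 1) j) p' - (softSymbolCompl L M β μ K (n + 1) j') p')) : ℝ) : ℂ) * (((β * (L : ℝ) ^ 2 : ℝ) : ℂ) * propCT L M β μ K p')))) *
                (V j t ![((p, σ), 1), ((p', σ), 0), (((omega0 M, y), 0), 0), (((omega0 M, x), 0), 1)] *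
                  V j t ![((p, σ), 0), ((p', σ), 1), ((((omega0 M).rev, Qm - y), 1), 0), ((((omega0 M).rev, Qm - x), 1), 1)])
            else 0)‖ ≤ Rd₁)
    (hd₂ : ‖(∑ p : FreqMomentum L M, ∑ σ : Fin 2, ∑ p' : FreqMomentum L M,
            if matsubaraInt M p'.1 + matsubaraInt M (omega0 M) = matsubaraInt M p.1 + matsubaraInt M (omega0 M) ∧ p'.2 = p.2 + x - y then
              ((((((Φ j' t p) : ℝ) : ℂ) * (((β * (L : ℝ) ^ 2 : ℝ) : ℂ) * propCT L M β μ K p)) * ((((Wd t p') : ℝ) : ℂ) * (((β * (L : ℝ) ^ 2 : ℝ) : ℂ) * propCT L M β μ K p'))) + (((((Wd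
                      t p) : ℝ) : ℂ) * (((β * (L : ℝ) ^ 2 : ℝ) : ℂ) * propCT L M β μ K p)) * ((((Φ j' t p') : ℝ) : ℂ) * (((β * (L : ℝ) ^ 2 : ℝ) : ℂ) * propCT L M β μ K p')))) *
                (V j t ![((p, σ), 1), ((p', σ), 0), (((omega0 M, y), 0), 0), (((omega0 M, x), 0), 1)] *
                  V j t ![((p, σ), 0), ((p', σ), 1), ((((omega0 M).rev, Qm - y), 1), 0), ((((omega0 M).rev, Qm - x), 1), 1)] -
                V j' t ![((p, σ), 1), ((p', σ), 0), (((omega0 M, y), 0), 0), (((omega0 M, x), 0), 1)] *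
                  V j' t ![((p, σ), 0), ((p', σ), 1), ((((omega0 M).rev, Qm - y), 1), 0), ((((omega0 M).rev, Qm - x), 1), 1)])
            else 0)‖ ≤ Rd₂)
    (hx₁ : ‖(∑ p : FreqMomentum L M, ∑ p' : FreqMomentum L M,
            if matsubaraInt M p'.1 + matsubaraInt M (omega0 M) + matsubaraInt M (omega0 M) + 1 = matsubaraInt M p.1 ∧ p'.2 = p.2 + Qm - x - y then
              ((((((((softSymbolCompl L M β μ K (n + 1) j) p - (softSymbolCompl L M β μ K (n + 1) j') p)) : ℝ) : ℂ) * (((β * (L : ℝ) ^ 2 : ℝ) : ℂ) * propCT L M β μ K p)) * ((((Wd t p')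
                      : ℝ) : ℂ) * (((β * (L : ℝ) ^ 2 : ℝ) : ℂ) * propCT L M β μ K p'))) + (((((Wd t p) : ℝ) : ℂ) * (((β * (L : ℝ) ^ 2 : ℝ) : ℂ) * propCT L M β μ K p)) *
                      ((((((softSymbolCompl L M β μ K (n + 1) j) p' - (softSymbolCompl L M β μ K (n + 1) j') p')) : ℝ) : ℂ) * (((β * (L : ℝ) ^ 2 : ℝ) : ℂ) * propCT L M β μ K p')))) *
                (V j t ![((p, 0), 1), ((p', 1), 0), (((omega0 M, y), 0), 0), ((((omega0 M).rev, Qm - x), 1), 1)] *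
                  V j t ![((p, 0), 0), ((p', 1), 1), ((((omega0 M).rev, Qm - y), 1), 0), (((omega0 M, x), 0), 1)])
            else 0)‖ ≤ Rx₁)
    (hx₂ : ‖(∑ p : FreqMomentum L M, ∑ p' : FreqMomentum L M,
            if matsubaraInt M p'.1 + matsubaraInt M (omega0 M) + matsubaraInt M (omega0 M) + 1 = matsubaraInt M p.1 ∧ p'.2 = p.2 + Qm - x - y then
              ((((((Φ j' t p) : ℝ) : ℂ) * (((β * (L : ℝ) ^ 2 : ℝ) : ℂ) * propCT L M β μ K p)) * ((((Wd t p') : ℝ) : ℂ) * (((β * (L : ℝ) ^ 2 : ℝ) : ℂ) * propCT L M β μ K p'))) + (((((Wd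
                      t p) : ℝ) : ℂ) * (((β * (L : ℝ) ^ 2 : ℝ) : ℂ) * propCT L M β μ K p)) * ((((Φ j' t p') : ℝ) : ℂ) * (((β * (L : ℝ) ^ 2 : ℝ) : ℂ) * propCT L M β μ K p')))) *
                (V j t ![((p, 0), 1), ((p', 1), 0), (((omega0 M, y), 0), 0), ((((omega0 M).rev, Qm - x), 1), 1)] *
                  V j t ![((p, 0), 0), ((p', 1), 1), ((((omega0 M).rev, Qm - y), 1), 0), (((omega0 M, x), 0), 1)] -
                V j' t ![((p, 0), 1), ((p', 1), 0), (((omega0 M, y), 0), 0), ((((omega0 M).rev, Qm - x), 1), 1)] *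
                  V j' t ![((p, 0), 0), ((p', 1), 1), ((((omega0 M).rev, Qm - y), 1), 0), (((omega0 M, x), 0), 1)])
            else 0)‖ ≤ Rx₂)
    (h6₁ : ‖(∑ p : FreqMomentum L M, ∑ σ : Fin 2,
            (((((Wd t p) : ℝ) : ℂ) * (((β * (L : ℝ) ^ 2 : ℝ) : ℂ) * propCT L M β μ K p)) * ((((((softSymbolCompl L M β μ K (n + 1) j) p - (softSymbolCompl L M β μ K (n + 1) j') p)) :
                    ℝ) : ℂ) * (((β * (L : ℝ) ^ 2 : ℝ) : ℂ) * propCT L M β μ K p))) *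
              (V6 j t ![((p, σ), 0), ((p, σ), 1), (((omega0 M, y), 0), 0), ((((omega0 M).rev, Qm - y), 1), 0), ((((omega0 M).rev, Qm - x), 1), 1),
                (((omega0 M, x), 0), 1)] *
                Sg j t p σ))‖ ≤ R6₁)
    (h6₂ : ‖(∑ p : FreqMomentum L M, ∑ σ : Fin 2,
            (((((Wd t p) : ℝ) : ℂ) * (((β * (L : ℝ) ^ 2 : ℝ) : ℂ) * propCT L M β μ K p)) * ((((Φ j' t p) : ℝ) : ℂ) * (((β * (L : ℝ) ^ 2 : ℝ) : ℂ) * propCT L M β μ K p))) *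
              (V6 j t ![((p, σ), 0), ((p, σ), 1), (((omega0 M, y), 0), 0), ((((omega0 M).rev, Qm - y), 1), 0), ((((omega0 M).rev, Qm - x), 1), 1),
                (((omega0 M, x), 0), 1)] *
                Sg j t p σ -
              V6 j' t ![((p, σ), 0), ((p, σ), 1), (((omega0 M, y), 0), 0), ((((omega0 M).rev, Qm - y), 1), 0), ((((omega0 M).rev, Qm - x), 1), 1),
                (((omega0 M, x), 0), 1)] *
                Sg j' t p σ))‖ ≤ R6₂)
    (hl₁ : ‖∑ z : TorusSite 2 L × MatsubaraIdx M, (fun z : TorusSite 2 L × MatsubaraIdx M => -(((((β * (L : ℝ) ^ 2 : ℝ) : ℂ)))⁻¹ * propCT L M β μ K (z.2, z.1) * propCT L M β μ K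
            (z.2.rev, Qm - z.1)) * ((((klScale klE0 (n + 1) - klScale klE0 n) * (-Wd t (z.2, z.1) * ((softSymbolCompl L M β μ K (n + 1) j) (z.2.rev, Qm - z.1) - (softSymbolCompl L M β
            μ K (n + 1) j') (z.2.rev, Qm - z.1)) - ((softSymbolCompl L M β μ K (n + 1) j) (z.2, z.1) - (softSymbolCompl L M β μ K (n + 1) j') (z.2, z.1)) * Wd t (z.2.rev, Qm - z.1))) :
            ℝ) : ℂ)) z *
          ((if z.1 ∈ klBall L μ 0 then
              V j t ![(((omega0 M, z.1), 0), 0), ((((omega0 M).rev, Qm - z.1), 1), 0), ((((omega0 M).rev, Qm - x), 1), 1), (((omega0 M, x), 0), 1)] *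
                V j t ![(((omega0 M, y), 0), 0), ((((omega0 M).rev, Qm - y), 1), 0), ((((omega0 M).rev, Qm - z.1), 1), 1), (((omega0 M, z.1), 0), 1)]
            else 0) -
            V j t ![(((z.2, z.1), 0), 0), (((z.2.rev, Qm - z.1), 1), 0), ((((omega0 M).rev, Qm - x), 1), 1), (((omega0 M, x), 0), 1)] *
              V j t ![(((omega0 M, y), 0), 0), ((((omega0 M).rev, Qm - y), 1), 0), (((z.2.rev, Qm - z.1), 1), 1), (((z.2, z.1), 0), 1)])‖ ≤ Rl₁)
    (hl₂ : ‖∑ z : TorusSite 2 L × MatsubaraIdx M, Br j' Qm t z *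
          (((if z.1 ∈ klBall L μ 0 then
              V j t ![(((omega0 M, z.1), 0), 0), ((((omega0 M).rev, Qm - z.1), 1), 0), ((((omega0 M).rev, Qm - x), 1), 1), (((omega0 M, x), 0), 1)] *
                V j t ![(((omega0 M, y), 0), 0), ((((omega0 M).rev, Qm - y), 1), 0), ((((omega0 M).rev, Qm - z.1), 1), 1), (((omega0 M, z.1), 0), 1)]
            else 0) -
            V j t ![(((z.2, z.1), 0), 0), (((z.2.rev, Qm - z.1), 1), 0), ((((omega0 M).rev, Qm - x), 1), 1), (((omega0 M, x), 0), 1)] *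
              V j t ![(((omega0 M, y), 0), 0), ((((omega0 M).rev, Qm - y), 1), 0), (((z.2.rev, Qm - z.1), 1), 1), (((z.2, z.1), 0), 1)]) -
            ((if z.1 ∈ klBall L μ 0 then
              V j' t ![(((omega0 M, z.1), 0), 0), ((((omega0 M).rev, Qm - z.1), 1), 0), ((((omega0 M).rev, Qm - x), 1), 1), (((omega0 M, x), 0), 1)] *
                V j' t ![(((omega0 M, y), 0), 0), ((((omega0 M).rev, Qm - y), 1), 0), ((((omega0 M).rev, Qm - z.1), 1), 1), (((omega0 M, z.1), 0), 1)]
            else 0) -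
            V j' t ![(((z.2, z.1), 0), 0), (((z.2.rev, Qm - z.1), 1), 0), ((((omega0 M).rev, Qm - x), 1), 1), (((omega0 M, x), 0), 1)] *
              V j' t ![(((omega0 M, y), 0), 0), ((((omega0 M).rev, Qm - y), 1), 0), (((z.2.rev, Qm - z.1), 1), 1), (((z.2, z.1), 0), 1)]))‖ ≤ Rl₂) :
    ‖((A' j Qm t + A j Qm t * diagonal (b' j Qm t) * A j Qm t) - (A' j' Qm t + A j' Qm t * diagonal (b' j' Qm t) * A j' Qm t)) x y‖ ≤
      (klScale klE0 n - klScale klE0 (n + 1)) * (2⁻¹ * Rhd + ((β * (L : ℝ) ^ 2) ^ 3)⁻¹ * (Rd₁ + Rd₂ + Rx₁ + Rx₂ + 2 * (R6₁ + R6₂))) + (Rl₁ + Rl₂) := by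
  exact klmd_defectDiff_le_rows L M β U μ K hβ n (klmd_softSymbolCompl_even L M β μ K (n + 1) j) (klmd_softSymbolCompl_even L M β μ K (n + 1) j') Qm Wd hWd
    (A j Qm) (A' j Qm) (b' j Qm) (by rw [hAdef]) (by rw [hA'def]) (by rw [hb'def]) (V j) (by rw [hV]) (V6 j) (by rw [hV6]) (Sg j) (by rw [hSg]) (Hd j) (by rw [hHd])
    (Φ j) (by rw [hΦ]) (Br j Qm) (by rw [hBr])
    (A j' Qm) (A' j' Qm) (b' j' Qm) (by rw [hAdef]) (by rw [hA'def]) (by rw [hb'def]) (V j') (by rw [hV]) (V6 j') (by rw [hV6]) (Sg j') (by rw [hSg]) (Hd j')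
    (by rw [hHd]) (Φ j') (by rw [hΦ]) (Br j' Qm) (by rw [hBr]) ht x y hRhd hd₁ hd₂ hx₁ hx₂ h6₁ h6₂ hl₁ hl₂


end Summit.HubbardSuperconductivity.HubbardSuperconductivity.Theorems.KLRegimeSplit

end
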